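import Summits.ResolutionOfSingularities.ResolutionOfSingularities.Theorems.WeightedInvariantLocalWeightedDropTrackCSurfaceGermsWonB
import Summits.ResolutionOfSingularities.ResolutionOfSingularities.Theorems.WeightedInvariantLocalWeightedDropSurfacePieces

/-!
# TRACK C modulo F-32bR: the banked concluder `CJS-B → W4 → T″ → LocalWeightedDrop`

[OURS · L1 W4.3 · chain w43, engine crux `LocalWeightedDrop` stmt-ResolutionOfSingularities-8899, registered skeleton v28
(`L/res-L1-w43-lead-1/LocalWeightedDrop_v28_plan1.lean`, sha16 b8b73808bd522080); res-type-088, ORDER (o1) of CHAIN w43 v4.4 as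
AMENDED by v4.4.1 (iii): keyed to the CORRECTED Cossart–Jannsen–Saito fact F-32bR
`Literature.AlgebraicGeometry.Resolution.CossartJannsenSaito2020EmbeddedSequenceB`, never to the superseded F-32b]
NOT a statement of any manuscript; the game (`CobordantGame.Won`) is the programme's own.  This file closes NOTHING by name.

* `localWeightedDrop_of_CJSB_of_residuals` — THE BANKED CONCLUDER: `CossartJannsenSaito2020EmbeddedSequenceB.{0} → W4 → T″ →
  LocalWeightedDrop` (W4 = `stub_wildWideApexHigherStartsWon`, T″ = `stub_tameWideApexHigherStartsWon` of skeleton v28, statements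
  VERBATIM as hypotheses), through the landed glue `localWeightedDrop_of_pieces` (`…SurfacePieces`) with its two surface hypotheses
  S2 / S3 discharged by `TrackC.surfaceGermsWon_of_CJSSequenceB` (`…TrackCSurfaceGermsWonB`, p497328).  Audit class: proof of the
  crux WITH EXTRA HYPOTHESES (one named published fact + the two open `N ≥ 4` residual cores) — not a closure; the by-name status
  of the skeleton (7 stubs) is unchanged.  The five `N = 3` class stubs as CJS-B instances: sibling `…TrackCStubInstancesB`.
-/

noncomputable section

open Literature.AlgebraicGeometry.Resolution

set_option linter.dupNamespace false -- mandated namespace of this single-conjunct summit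

namespace Summit.ResolutionOfSingularities.ResolutionOfSingularities.Theorems.TrackC

/-- **THE BANKED CONCLUDER modulo F-32bR.** The corrected Cossart–Jannsen–Saito sequence fact, together with the two `N ≥ 4`
residual cores of the registered engine skeleton v28 — W4 `stub_wildWideApexHigherStartsWon` and T″ `stub_tameWideApexHigherStartsWon`,
statements VERBATIM as hypotheses — implies the crux `LocalWeightedDrop`: the landed glue `localWeightedDrop_of_pieces` with its two
surface hypotheses S2 / S3 discharged by `surfaceGermsWon_of_CJSSequenceB`.  A proof of the item WITH EXTRA HYPOTHESES, not a
closure. [OURS · L1 W4.3] -/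
theorem localWeightedDrop_of_CJSB_of_residuals (hCJS : CossartJannsenSaito2020EmbeddedSequenceB.{0})
    (hW4 : ∀ (p : ℕ), p.Prime → ∀ (k : Type) [Field k] [CharP k p] [IsAlgClosed k]
        (n : ℕ), (∀ m : ℕ, m < n + 4 → ∀ g : MvPowerSeries (Fin m) k,
          CobordantGame.IsSingular k g → CobordantGame.Won k m g) →
        ∀ (f : MvPowerSeries (Fin (n + 4)) k), CobordantGame.IsSingular k f →
        (∀ g : MvPowerSeries (Fin (n + 4)) k, CobordantGame.IsSingular k g → g.order < f.order →
          CobordantGame.Won k (n + 4) g) →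
        ∀ (d : ℕ), f.order = d → p ∣ d →
        (∃ ℓ : Fin (n + 4) → k, ∀ i j : Fin (n + 4),
          MvPowerSeries.coeff (Finsupp.single i 1 + Finsupp.single j 1) f =
            MvPowerSeries.coeff (Finsupp.single i 1 + Finsupp.single j 1)
              ((∑ l, MvPowerSeries.C (ℓ l) * MvPowerSeries.X l) ^ 2)) →
        (2 < d → ∃ c₁ c₂ : Fin (n + 4) → k, (∀ α β : k, α • c₁ + β • c₂ = 0 → α = 0 ∧ β = 0) ∧
          (∀ v : Fin (n + 4) → k, CobordantChart.initEval (fun _ : Fin (n + 4) => 1) (v + c₁) d f =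
            CobordantChart.initEval (fun _ : Fin (n + 4) => 1) v d f) ∧
          (∀ v : Fin (n + 4) → k, CobordantChart.initEval (fun _ : Fin (n + 4) => 1) (v + c₂) d f =
            CobordantChart.initEval (fun _ : Fin (n + 4) => 1) v d f)) →
        CobordantGame.Won k (n + 4) f)
    (hT : ∀ (p : ℕ), p.Prime → ∀ (k : Type) [Field k] [CharP k p] [IsAlgClosed k]
      (n : ℕ), (∀ m : ℕ, m < n + 4 → ∀ g : MvPowerSeries (Fin m) k,
        CobordantGame.IsSingular k g → CobordantGame.Won k m g) →
      ∀ (f : MvPowerSeries (Fin (n + 4)) k), CobordantGame.IsSingular k f →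
      (∀ g : MvPowerSeries (Fin (n + 4)) k, CobordantGame.IsSingular k g → g.order < f.order →
        CobordantGame.Won k (n + 4) g) →
      ∀ (d : ℕ), f.order = d → ¬ p ∣ d →
      (∃ ℓ : Fin (n + 4) → k, ∀ i j : Fin (n + 4),
        MvPowerSeries.coeff (Finsupp.single i 1 + Finsupp.single j 1) f =
          MvPowerSeries.coeff (Finsupp.single i 1 + Finsupp.single j 1)
            ((∑ l, MvPowerSeries.C (ℓ l) * MvPowerSeries.X l) ^ 2)) →
      (2 < d → ∃ c₁ c₂ : Fin (n + 4) → k, (∀ α β : k, α • c₁ + β • c₂ = 0 → α = 0 ∧ β = 0) ∧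
        (∀ v : Fin (n + 4) → k, CobordantChart.initEval (fun _ : Fin (n + 4) => 1) (v + c₁) d f =
          CobordantChart.initEval (fun _ : Fin (n + 4) => 1) v d f) ∧
        (∀ v : Fin (n + 4) → k, CobordantChart.initEval (fun _ : Fin (n + 4) => 1) (v + c₂) d f =
          CobordantChart.initEval (fun _ : Fin (n + 4) => 1) v d f)) →
      CobordantGame.Won k (n + 4) f) :
    Summit.ResolutionOfSingularities.ResolutionOfSingularities.Theses.WeightedInvariant.LocalWeightedDrop :=
  localWeightedDrop_of_pieces
    (fun k _ _ _ _ f hf _ _ _ => surfaceGermsWon_of_CJSSequenceB hCJS 2 Nat.prime_two k f hf)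
    (fun p hp k _ _ _ _ f hf _ _ _ _ _ _ _ => surfaceGermsWon_of_CJSSequenceB hCJS p hp k f hf)
    hW4 hT

end Summit.ResolutionOfSingularities.ResolutionOfSingularities.Theorems.TrackC

end
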